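import Summits.CriticalPhenomena.SAWScalingLimit.Theses.SAWTotalPositivity
import Summits.CriticalPhenomena.SAWScalingLimit.Theorems.SAWTotalPositivityBoundaryTP2Defs
import Summits.CriticalPhenomena.SAWScalingLimit.Theorems.SAWTotalPositivityBoundaryTP2Kernel
import Summits.CriticalPhenomena.SAWScalingLimit.Theorems.SAWTotalPositivityBoundaryTP2Symmetry
import Summits.CriticalPhenomena.SAWScalingLimit.Theorems.SAWRenewalTightnessStripMassConservation
import Summits.CriticalPhenomena.SAWScalingLimit.Theorems.BoundaryTP2Negative_WithoutInterlacing
import Summits.CriticalPhenomena.SAWScalingLimit.Theorems.BoundaryTP2Negative_Midpoints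
import Literature.Probability.RandomPlanarGeometry.SAWLowerBound
import HarnessLib

/-!
# SKELETON — crux `BoundaryTP2` (stmt-CriticalPhenomena-7115), line `renewal-cauchy-binet-kesten-budget`

Idea card `Cruxes/BoundaryTP2/Ideas/renewal-cauchy-binet-kesten-budget.md` (crux-ideate r1, ideator 1;
triage r1-1/2/3: pass, with sharpenings), turned into a checked skeleton by the crux planner
`planner-cruxplan-stmt-CriticalPhenomena-7115-renewal-cauchy-binet-0` (2026-08-16).

## The line in one paragraph

Work with the combinatorial core of the crux (lead's vocabulary `…Theorems.BoundaryTP2.pathKernel`,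
`Interlaced`, `InterlacedTP2At`; the landed transfer `boundaryTP2_of_graphTP2At` turns it into the crux
as typed) and prove the interlacing-only TP₂ inequality at `x_c` for every finite subgraph `H ≤ ℤ²` by
strong induction on the number of edges of `H`.  INDUCTIVE STEP for a two-edge quadruple (sources
`p₁ ∼ p₄`, targets `p₂ ∼ p₃`, interlaced): cut `H` along a vertex cut `(A, Aᶜ)` with the sources in
`A` and the targets outside (a lattice line transverse to the pair — the renewal line — or a bottleneck
cut; the cut is the PROVER'S CHOICE, triage r1-2/r1-3) and split every kernel `Z = Z¹ + Zᵉ` into the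
single-crossing sector (exactly one step across the cut: there the polymer is Markov and
`Z¹(a,b) = x Σ_{(u,v)} Z_A(a,u) Z_{Aᶜ}(v,b)`) and the entangled rest.  Then

* `stub_singleCrossingCauchyBinet` — Cauchy–Binet: the single-crossing minor `N₁₁ − C₁₁` is
  `x² Σ_{pairs of cut edges} (ℓ₁ − ℓ₂)(μ₁ − μ₂)`, so `C₁₁ ≤ N₁₁` as soon as every cut-edge pair
  satisfies the sign condition `CutPairSign` ("cross-glued ≤ nested-glued");
* `stub_cutPairSign` — the sign condition holds for EVERY vertex cut, by path surgery: a strictly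
  wrong-signed pair would give, through the induction hypothesis on the two sides `H[A]`, `H[Aᶜ]`
  (and their one-edge pendant extensions in the degenerate cases where a source is itself a cut
  vertex), vertex-disjoint paths `p₁ → u`, `u' → p₄` below and `v → p₃`, `p₂ → v'` above, which glue
  along the two cut edges into disjoint paths `p₁ → p₃`, `p₄ → p₂` of `H` — contradicting interlacing.
  This is "LGV switching at a LINE is legal for self-avoiding walks": no planarity, no face
  structure, no orientation bookkeeping is needed, only interlacing in `H`;
* `stub_entangledBudget` (HARDEST, the line's one analytic conjecture) — for SOME cut the entangled
  rest costs at most the Kesten budget: `N − C ≥ (1 − B)(N₁₁ − C₁₁)` with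
  `B = spanOneBudget = Σ_{s ∈ spanOneFamily} x_c^{|s|} ≈ 0.8417`, the critical Kraft mass of the
  span-one irreducible bridges (`SAW.spanOneFamily`, in tree), which is `≤ 1` by the PROVED Kraft
  inequality `StripMass.sum_pow_criticalFugacity_le_one` (Kesten's renewal bound) — stated additively
  in `ℝ≥0∞` as `C + B·C₁₁ + N₁₁ ≤ N + B·N₁₁ + C₁₁`;
* `stub_twoEdgeReduction` — Fekete + Menger: consecutive (two-edge) minors control all disjointly
  realisable interlaced minors of the same graph (ratio chaining along the two arcs of the common face);
  non-realisable ones factor through a cut vertex down to boundary three-point instances, which are either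
  smaller (induction hypothesis) or irreducible (a single pendant beyond the cut vertex) — hence the fifth stub;
* `stub_boundaryThreePoint` (analytic base case) — `Z_B(c,p)Z_B(c,q) ≤ Z_B(p,q)` at `x_c` for boundary sites
  `c` of every finite `B ≤ ℤ²`: the instances of the carrier that no induction reaches; it contains the uniform
  boundary two-point bound `Z_B(w,w') ≤ 1`, which — structural remark of this planner — the crux AS TYPED
  already implies (non-induced unit-square construction, docstring of `BoundaryThreePointAt`): the crux
  subsumes a half-plane critical bubble bound with constant `1`.

Composition (`BoundaryTP2_of`, sorry-free): budget-swap bookkeeping in `ℝ≥0∞`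
(`B ≤ 1`, `C₁₁ ≤ N₁₁` ⇒ `C ≤ N`), strong induction on `H.edgeSet.ncard`, then
`graphTP2At_of_interlacedTP2At` and `boundaryTP2_of_graphTP2At` (both landed, `…BoundaryTP2Kernel`).

## Disproof / negatives honoured

`boundaryTP2_false_without_interlacing` (imported): interlacing is kept verbatim in every stub and is
the ONLY input of the sign lemma; `not_midpointTP2_all_fugacities` / `midpointTP2_fails_at_three_fifths`
(imported): the line is fugacity-dependent by construction — `x ≤ x_c` enters exactly once, through
`spanOneBudget ≤ 1` (Kraft at `x_c`); `circularTP3_fails_at_xc`: only 2 × 2 minors are composed;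
`exists_simplyConnected_domain_with_annular_meshGraph`: everything is stated for arbitrary finite
`H ≤ zdGraph 2` (holes, interior faces, non-induced subgraphs included).  Triage sharpenings acted on:
the cut is existential (fixed mid-height cuts are refuted as a PRICING device on `2 × W`, `W ≥ 14`);
the pricing statement is a signed, sector-level inequality (not a mass charging); the Kraft budget is
the tree theorem, reused, not re-landed.
-/

noncomputable section

namespace Summit.CriticalPhenomena.SAWScalingLimit.Cruxes.BoundaryTP2.RenewalCauchyBinetKestenBudget

open Literature.Probability.LatticeModels Literature.Probability.RandomPlanarGeometry
open Summit.CriticalPhenomena.SAWScalingLimit.Theorems.BoundaryTP2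
open scoped ENNReal BigOperators

variable {V : Type*}

/-! ## Vocabulary of the line (cuts, sectors, the inductive carrier) -/

/-- The part of `H` inside the vertex set `A`: the edges of `H` with both ends in `A` (same vertex
type; the vertices outside `A` become isolated).  Spelled exactly as in the landed
`stub_twoEdgeCut_factor`. [folklore] -/
def sideGraph (H : SimpleGraph V) (A : Set V) : SimpleGraph V :=
  SimpleGraph.fromRel fun u v => H.Adj u v ∧ u ∈ A ∧ v ∈ A

/-- Kernel of one side of the cut: `Z_A(a,b) = pathKernel (sideGraph H A) x a b`. [folklore] -/
abbrev sideKernel (H : SimpleGraph V) (x : ℝ) (A : Set V) (a b : V) : ℝ≥0∞ :=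
  pathKernel (sideGraph H A) x a b

open Classical in
/-- The number of steps of the walk `p` across the vertex cut `(A, Aᶜ)` (in either direction). [folklore] -/
def cutCrossings {H : SimpleGraph V} (A : Set V) {a b : V} (p : H.Walk a b) : ℕ :=
  p.darts.countP fun d => decide (d.fst ∈ A ↔ d.snd ∉ A)

/-- The SINGLE-CROSSING SECTOR of the kernel: `Z¹_A(a,b) = Σ x^{|γ|}` over the self-avoiding paths
`γ : a → b` of `H` with exactly one step across the cut `(A, Aᶜ)` (the renewal sector: there the path is
`(path in H[A]) · (cut edge) · (path in H[Aᶜ])`).  The entangled sector is the complement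
(`pathKernelOn_add_compl`). [folklore] -/
def sectorKernel (H : SimpleGraph V) (x : ℝ) (A : Set V) (a b : V) : ℝ≥0∞ :=
  pathKernelOn H x a b {γ | cutCrossings A γ.1 = 1}

/-- The CUT-PAIR SIGN CONDITION for a quadruple with sources `p₁, p₄ ∈ A`, targets `p₂, p₃ ∉ A` and two
cut edges `(u,v)`, `(u',v')` (`u, u' ∈ A`, `v, v' ∉ A`): with `ℓ₁ = Z_A(p₁,u) Z_A(p₄,u')`,
`ℓ₂ = Z_A(p₁,u') Z_A(p₄,u)`, `μ₁ = Z_{Aᶜ}(v,p₂) Z_{Aᶜ}(v',p₃)`, `μ₂ = Z_{Aᶜ}(v,p₃) Z_{Aᶜ}(v',p₂)`,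
the cross-glued products weigh at most the nested-glued ones: `ℓ₁ μ₂ + ℓ₂ μ₁ ≤ ℓ₁ μ₁ + ℓ₂ μ₂`, i.e.
`(ℓ₁ − ℓ₂)(μ₁ − μ₂) ≥ 0` — the summand of the Cauchy–Binet expansion of the single-crossing minor.
Statement interface; nothing is asserted here. [folklore] -/
def CutPairSign (H : SimpleGraph V) (x : ℝ) (A : Set V) (p₁ p₂ p₃ p₄ u v u' v' : V) : Prop :=
  sideKernel H x A p₁ u * sideKernel H x A p₄ u' * (sideKernel H x Aᶜ v p₃ * sideKernel H x Aᶜ v' p₂) +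
      sideKernel H x A p₁ u' * sideKernel H x A p₄ u * (sideKernel H x Aᶜ v p₂ * sideKernel H x Aᶜ v' p₃) ≤
    sideKernel H x A p₁ u * sideKernel H x A p₄ u' * (sideKernel H x Aᶜ v p₂ * sideKernel H x Aᶜ v' p₃) +
      sideKernel H x A p₁ u' * sideKernel H x A p₄ u * (sideKernel H x Aᶜ v p₃ * sideKernel H x Aᶜ v' p₂)

/-- Interlacing-only TP₂ at fugacity `x` for ONE graph `H` (the lead's `InterlacedTP2At x` is
`∀ H ≤ zdGraph 2, H.support.Finite → InterlacedTP2On x H`, definitionally).  Statement interface;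
nothing is asserted here. [folklore] -/
def InterlacedTP2On (x : ℝ) (H : SimpleGraph (Site 2)) : Prop :=
  ∀ p₁ p₂ p₃ p₄ : Site 2, p₁ ≠ p₂ → p₁ ≠ p₃ → p₁ ≠ p₄ → p₂ ≠ p₃ → p₂ ≠ p₄ → p₃ ≠ p₄ →
    Interlaced H p₁ p₂ p₃ p₄ →
      pathKernel H x p₁ p₃ * pathKernel H x p₂ p₄ ≤ pathKernel H x p₁ p₂ * pathKernel H x p₃ p₄

/-- The TWO-EDGE instances of `InterlacedTP2On x H`: sources `p₄ ∼ p₁` and targets `p₂ ∼ p₃` are edges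
of `H` (consecutive minors; Fekete).  Statement interface; nothing is asserted here. [folklore] -/
def TwoEdgeTP2On (x : ℝ) (H : SimpleGraph (Site 2)) : Prop :=
  ∀ p₁ p₂ p₃ p₄ : Site 2, p₁ ≠ p₂ → p₁ ≠ p₃ → p₁ ≠ p₄ → p₂ ≠ p₃ → p₂ ≠ p₄ → p₃ ≠ p₄ →
    H.Adj p₄ p₁ → H.Adj p₂ p₃ → Interlaced H p₁ p₂ p₃ p₄ →
      pathKernel H x p₁ p₃ * pathKernel H x p₂ p₄ ≤ pathKernel H x p₁ p₂ * pathKernel H x p₃ p₄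

/-- The INDUCTION HYPOTHESIS below `H`: interlacing-only TP₂ at `x` for every subgraph of `ℤ²` with
finitely many non-isolated vertices and strictly fewer edges than `H` (the two sides of any cut of `H`,
their one-edge pendant extensions, vertex deletions … all qualify).  Statement interface. [folklore] -/
def IHBelow (x : ℝ) (H : SimpleGraph (Site 2)) : Prop :=
  ∀ H' : SimpleGraph (Site 2), H' ≤ zdGraph 2 → H'.support.Finite →
    H'.edgeSet.ncard < H.edgeSet.ncard → InterlacedTP2On x H'

/-- The BOUNDARY THREE-POINT INEQUALITY at fugacity `x` (the carrier's irreducible base case): for every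
finite `B ≤ ℤ²`, every site `c` with a FREE lattice neighbour `ℓ` (a neighbour carrying no edge of `B` — "`c` is a
boundary site") and all `p, q` (the three pairwise distinct), the two-leg star from `c` weighs at most the direct
connection: `Z_B(c,p) · Z_B(c,q) ≤ Z_B(p,q)`.  Hanging the pendant edge `cℓ` on `B` turns it into the interlaced
(non-realisable) four-point instance `(ℓ, c, q, p)` of `InterlacedTP2At x` on `B + cℓ`, and conversely every
interlaced quadruple that is NOT disjointly realisable factors through a cut vertex (Menger) down to such
three-point instances — when the far side of the cut vertex is a single pendant edge no smaller graph is left,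
so this family cannot be reached by the induction and is registered as its own stub (`stub_boundaryThreePoint`).
It contains the two-point bound `Z_B(w,w') ≤ 1` for boundary sites (take `p = w'`, `q` = a pendant hung at `w'`).
STRUCTURAL REMARK (this planner): the crux AS TYPED already implies that two-point bound — for `B` finite and
`w, w'` with free neighbours `s ∼ s'` outside `B`, the quadruple `(w, s, s', w')` of the graph `B + ws + ss' + s'w'`
satisfies (i)–(iii) and its TP₂ inequality reads `(1 − Z_B(w,w'))(1 − x) ≥ 0` — so `BoundaryTP2` contains a
half-plane critical bubble bound with constant `1` (cf. the route's crux `CriticalBubbleBound`).  Statement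
interface; nothing is asserted here. [folklore] -/
def BoundaryThreePointAt (x : ℝ) : Prop :=
  ∀ B : SimpleGraph (Site 2), B ≤ zdGraph 2 → B.support.Finite →
    ∀ c p q ℓ : Site 2, c ≠ p → c ≠ q → p ≠ q → (zdGraph 2).Adj c ℓ → ℓ ∉ B.support →
      pathKernel B x c p * pathKernel B x c q ≤ pathKernel B x p q

/-- The KESTEN BUDGET of the line: the critical Kraft mass `Σ_{s ∈ S₁} x_c^{|s|}` of the tree's family
`SAW.spanOneFamily` of span-one irreducible bridges `[+e₀] ++ k·[±e₁]` (`k ≤ 60`) — numerically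
`x_c (1 + x_c)/(1 − x_c) − O(x_c^{62}) ≈ 0.8417`; it is `≤ 1` by Kraft's inequality at `x_c`
(`spanOneBudget_le_one` below, from the PROVED `StripMass.sum_pow_criticalFugacity_le_one`). [folklore] -/
def spanOneBudget : ℝ :=
  ∑ s ∈ SAW.spanOneFamily, SAW.criticalFugacity ^ s.length

/-! ## Registered stubs -/

/-- STUB (M; Cauchy–Binet for the renewal sector — pure algebra, any graph, any `x ≥ 0`).  For a vertex
cut `(A, Aᶜ)` with the sources `p₁, p₄` inside and the targets `p₂, p₃` outside, the single-crossing
sector factorises, `Z¹_A(a,b) = x · Σ_{(u,v) ∈ ∂A} Z_A(a,u) Z_{Aᶜ}(v,b)` (unique decomposition at the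
unique cut edge; cf. the landed `stub_twoEdgeCut_factor`), hence by the basic composition formula
`N₁₁ − C₁₁ = Z¹(p₁,p₂)Z¹(p₄,p₃) − Z¹(p₁,p₃)Z¹(p₄,p₂) = x² Σ_{ {c,c'} ⊆ ∂A } (ℓ₁ − ℓ₂)(μ₁ − μ₂)`
(diagonal terms vanish); so if every pair of distinct cut edges satisfies `CutPairSign`, the crossing
single-crossing product is at most the nested one.  [Karlin1968 Ch. 3 §1 (basic composition formula);
KarlinMcgregor1959] -/
theorem stub_singleCrossingCauchyBinet (H : SimpleGraph V) (x : ℝ) (hx : 0 ≤ x)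
    (hfin : H.support.Finite) (A : Set V) (p₁ p₂ p₃ p₄ : V)
    (h₁ : p₁ ∈ A) (h₄ : p₄ ∈ A) (h₂ : p₂ ∉ A) (h₃ : p₃ ∉ A)
    (hsign : ∀ u v u' v' : V, H.Adj u v → u ∈ A → v ∉ A → H.Adj u' v' → u' ∈ A → v' ∉ A →
      (u ≠ u' ∨ v ≠ v') → CutPairSign H x A p₁ p₂ p₃ p₄ u v u' v') :
    sectorKernel H x A p₁ p₃ * sectorKernel H x A p₄ p₂ ≤
      sectorKernel H x A p₁ p₂ * sectorKernel H x A p₄ p₃ := by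
  sorry

/-- STUB (M; the sign lemma — "switching at a line is legal for self-avoiding walks").  For ANY vertex
cut `(A, Aᶜ)` of a finite `H ≤ ℤ²` separating the sources `p₁, p₄` from the targets `p₂, p₃` of an
interlaced quadruple, and any two distinct cut edges `(u,v)`, `(u',v')`, the cut-pair sign condition
holds, GIVEN interlacing-only TP₂ for the graphs with fewer edges than `H` (used on `sideGraph H A`,
`sideGraph H Aᶜ` and, when a source/target is itself an end of one of the two cut edges, on their
extensions by that single cut edge — a pendant, which turns the needed three-point inequality
`Z(w,a)Z(w,b) ≤ Z(a,b)` into an interlaced four-point one, cf. the landed `stub_pendant_threePoint`;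
all of these have fewer edges than `H` because the source edge `p₄p₁`, the target edge `p₂p₃` and the
two cut edges are four distinct edges of `H`).
Proof idea: if `ℓ₁ < ℓ₂` and `μ₁ > μ₂` (the other wrong-signed case is symmetric), TP₂ below forbids
`Interlaced (sideGraph H A) p₁ u u' p₄`, giving disjoint paths `p₁ → u'`, `u → p₄` in `A`, and TP₂ above
forbids `Interlaced (sideGraph H Aᶜ) v p₃ p₂ v'`, giving disjoint paths `v → p₂`, `p₃ → v'` outside;
glued along the cut edges they are disjoint self-avoiding paths `p₁ → u' → v' → p₃` and
`p₄ → u → v → p₂` of `H`, contradicting `Interlaced H p₁ p₂ p₃ p₄`.  No planarity is used.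
[Fomin2001 (loop-erased switching, the Markov case); this lemma is its self-avoiding substitute] -/
theorem stub_cutPairSign (x : ℝ) (hx : 0 ≤ x) (H : SimpleGraph (Site 2)) (hH : H ≤ zdGraph 2)
    (hfin : H.support.Finite) (ih : IHBelow x H) (A : Set (Site 2)) (p₁ p₂ p₃ p₄ : Site 2)
    (h₁ : p₁ ∈ A) (h₄ : p₄ ∈ A) (h₂ : p₂ ∉ A) (h₃ : p₃ ∉ A) (he : H.Adj p₄ p₁) (hf : H.Adj p₂ p₃)
    (hI : Interlaced H p₁ p₂ p₃ p₄) (u v u' v' : Site 2)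
    (huv : H.Adj u v) (hu : u ∈ A) (hv : v ∉ A) (hu'v' : H.Adj u' v') (hu' : u' ∈ A) (hv' : v' ∉ A)
    (hne : u ≠ u' ∨ v ≠ v') :
    CutPairSign H x A p₁ p₂ p₃ p₄ u v u' v' := by
  sorry

/-- STUB (M/L; Fekete + Menger — consecutive minors and boundary three-point instances suffice; `x`-uniform
as an implication).  For a finite `H ≤ ℤ²`: interlacing-only TP₂ below `H` (`IHBelow`), the TWO-EDGE instances of
`H` and the boundary three-point family at the same `x` give interlacing-only TP₂ for ALL quadruples of `H`.
(a) Disjointly realisable interlaced quadruples (hypotheses (ii), (iii) of the crux): chain the ratio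
monotonicity `Z(a,p₃)/Z(a,p₂) ≤ Z(a',p₃)/Z(a',p₂)` along a path `p₁ = a₀ ∼ a₁ ∼ … ∼ a_k = p₄` of `H` on which every
`(aᵢ, p₂, p₃, aᵢ₊₁)` stays interlaced (the arc of the common face: by the planar 2-linkage theorem an interlaced,
disjointly realisable quadruple lies on a common face in cyclic order), then the same on the target side — all
kernels are positive on a component for `x > 0` (`x = 0` is trivial); this is Fekete's criterion "consecutive
2 × 2 minors `≥ 0` ⇒ TP₂".  (b) Non-realisable interlaced quadruples: by Menger a single vertex `c` separates
`{p₁,p₂}` from `{p₃,p₄}` (or `{p₁,p₄}` from `{p₂,p₃}`); the kernels factor through `c` (landed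
`stub_cutVertex_factor`) and the inequality reduces to boundary three-point inequalities
`Z(c,p)Z(c,q) ≤ Z(p,q)` in the two blocks — instances of `IHBelow` (pendant trick) when the block plus a pendant
is smaller than `H`, and of the hypothesis `BoundaryThreePointAt x` otherwise (the far side is a single pendant
edge).  COUNTER-EXAMPLE showing (b) is needed: on the unit square with one pendant edge the quadruple
(leaf, centre, ·, ·) violates TP₂ for `x > 0.6436` although every two-edge instance of that graph is an equality
and every graph with fewer edges is TP₂ at such `x` — so no `x`-free reduction to two-edge instances alone exists.
[Karlin1968 Ch. 2 (Fekete's criterion); GantmacherKrein2002; Seymour1980/Thomassen1980 (planar 2-linkage)] -/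
theorem stub_twoEdgeReduction (x : ℝ) (hx : 0 ≤ x) (H : SimpleGraph (Site 2)) (hH : H ≤ zdGraph 2)
    (hfin : H.support.Finite) (ih : IHBelow x H) (h2 : TwoEdgeTP2On x H)
    (h3 : BoundaryThreePointAt x) : InterlacedTP2On x H := by
  sorry

/-- STUB (XL — the HARDEST; the line's analytic conjecture: the entangled remainder is paid from
Kesten's budget).  For every finite `H ≤ ℤ²`, given interlacing-only TP₂ below `H`, every interlaced
TWO-EDGE quadruple (`p₄ ∼ p₁` sources, `p₂ ∼ p₃` targets) admits a vertex cut `A ∋ p₁, p₄`,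
`A ∌ p₂, p₃` — prover's choice: the intended witnesses are the half-planes `{v | v i ≤ c}` /
`{v | c < v i}` of a lattice line transverse to the pair (two disjoint lattice edges are always
separated by such a line) or the source side of a bottleneck edge cut — such that, with
`N = Z(p₁,p₂)Z(p₄,p₃)`, `C = Z(p₁,p₃)Z(p₄,p₂)` and their single-crossing sectors `N₁₁`, `C₁₁`,
`C + B·C₁₁ + N₁₁ ≤ N + B·N₁₁ + C₁₁`, i.e. `N − C ≥ (1 − B)·(N₁₁ − C₁₁)`, where
`B = spanOneBudget ≈ 0.8417` is the critical Kraft mass of the span-one irreducible bridges: the full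
minor retains at least the fraction `1 − B` of the Cauchy–Binet (renewal-sector) minor; equivalently the
signed entangled remainder `T₁₃ + T₃₃ = (N − C) − (N₁₁ − C₁₁)` is `≥ −B·(N₁₁ − C₁₁)`.
DATA (all at `x_c`, `R := 1 − (N − C)/(N₁₁ − C₁₁)`, the stub says `min_A R ≤ 0.8417`): with the best
axis cut `R ≤ 0.2617` on every ladder `2 × W`, `W ≤ 14` (saturating), `≤ 0.141` on `3 × W`, `W ≤ 8`,
`0.144 / 0.137 / 0.135` on `4 × 4 / 5 × 4 / 6 × 4` (triage r1-2), `0.150 ↘ 0.109` on squares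
`L = 4…7` (r1-1); interior unit squares of boxes `4 × 4 … 6 × 6`: `R = 0.009 … 0.031` (half-plane cut),
hole faces `≤ 0.005` (this planner, `exp/sector_cuts.py`); a FIXED mid-height cut is NOT a witness on
long ladders (`R = 0.862 > 0.8417` at `2 × 14`, → 1⁻).  Why it might fail: at criticality both `R` and
any Kraft budget tend to `1⁻` in adverse geometries (long cut lines in low boxes: `W × 4` mid-cut
`R = 0.150 → 0.405` for `W = 4 → 14`), so the prover must really use the freedom in `A`; no
sign-respecting charging map is known (triage r1-1 finding 1: masses ≠ residues).
[Kesten1963SAW §4; MadrasSlade1993 §4.2 (A(z_c) = 1, here only `≤ 1`); Jensen2004SAWLowerBounds §2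
(the span-one family)] -/
theorem stub_entangledBudget (H : SimpleGraph (Site 2)) (hH : H ≤ zdGraph 2)
    (hfin : H.support.Finite) (ih : IHBelow SAW.criticalFugacity H) (p₁ p₂ p₃ p₄ : Site 2)
    (h12 : p₁ ≠ p₂) (h13 : p₁ ≠ p₃) (h14 : p₁ ≠ p₄) (h23 : p₂ ≠ p₃) (h24 : p₂ ≠ p₄) (h34 : p₃ ≠ p₄)
    (he : H.Adj p₄ p₁) (hf : H.Adj p₂ p₃) (hI : Interlaced H p₁ p₂ p₃ p₄) :
    ∃ A : Set (Site 2), p₁ ∈ A ∧ p₄ ∈ A ∧ p₂ ∉ A ∧ p₃ ∉ A ∧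
      pathKernel H SAW.criticalFugacity p₁ p₃ * pathKernel H SAW.criticalFugacity p₄ p₂ +
          ENNReal.ofReal spanOneBudget *
            (sectorKernel H SAW.criticalFugacity A p₁ p₃ * sectorKernel H SAW.criticalFugacity A p₄ p₂) +
          sectorKernel H SAW.criticalFugacity A p₁ p₂ * sectorKernel H SAW.criticalFugacity A p₄ p₃ ≤
        pathKernel H SAW.criticalFugacity p₁ p₂ * pathKernel H SAW.criticalFugacity p₄ p₃ +
          ENNReal.ofReal spanOneBudget *
            (sectorKernel H SAW.criticalFugacity A p₁ p₂ * sectorKernel H SAW.criticalFugacity A p₄ p₃) +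
          sectorKernel H SAW.criticalFugacity A p₁ p₃ * sectorKernel H SAW.criticalFugacity A p₄ p₂ := by
  sorry

/-- STUB (L/XL, analytic — the carrier's irreducible base case at `x_c`).  The boundary three-point inequality
`Z_B(c,p) Z_B(c,q) ≤ Z_B(p,q)` at `x_c` for every finite `B ≤ ℤ²`, every boundary site `c` (a lattice neighbour of
`c` carries no edge of `B`) and all `p, q`.  It is an instance family of the lead's carrier `InterlacedTP2At x_c`
(pendant trick, landed `stub_pendant_threePoint` gives the converse direction) that no induction on `B` can
reach, and it contains the uniform two-point bound `Z_B(w,w') ≤ 1` for boundary sites — which the crux AS TYPED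
also implies (structural remark in `BoundaryThreePointAt`), so this exposure is the crux's, not the line's.
DATA (lead, cycle 1): on all boxes `≤ 6 × 6` at `x ∈ {x_c, 1/2.6, 1/2.7}` the ratio `Z(p,q)/(Z(c,p)Z(c,q))` has
minimum `1.075 → 1.106`, increasing with the size (tightest: `p, q` the two boundary neighbours of `c`;
half-plane limit of `Z(c,c±e₁) ≈ 0.51–0.55`); `max Z(w,w') = 0.489`.  Why it might fail / why hard: it is a
UNIFORM bound on critical boundary two-point functions (finiteness of the half-plane bubble is not in print;
cf. the route's `CriticalBubbleBound`, Madras–Slade 1993 p. 22); the local margin is ~8 %.  A renewal proof would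
bound `Z_B(c,·)` from a boundary site by Kesten's irreducible-bridge masses (the walk from a boundary site starts
with a half-space step: bridge-like decomposition), which is where this line expects to pay it from the same
budget. [MadrasSlade1993 §4.2, §1.4 (two-point function); Kesten1963SAW] -/
theorem stub_boundaryThreePoint : BoundaryThreePointAt SAW.criticalFugacity := by
  sorry

/-! ## Composition (sorry-free below this line) -/

/-- The Kesten budget is at most one: Kraft's inequality at `x_c` for the admissible family
`spanOneFamily` (PROVED in tree: `StripMass.sum_pow_criticalFugacity_le_one`, from Kesten's renewal
bound `SAW.Renewal.le_connectiveConstant_of_kraft`; `spanOneFamily_spec` certifies irreducibility). -/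
theorem spanOneBudget_le_one : spanOneBudget ≤ 1 :=
  Summit.CriticalPhenomena.SAWScalingLimit.Theorems.StripMass.sum_pow_criticalFugacity_le_one
    fun s hs => (SAW.spanOneFamily_spec s hs).1

/-- `0 ≤ x_c`. -/
theorem criticalFugacity_nonneg : 0 ≤ SAW.criticalFugacity :=
  Summit.CriticalPhenomena.SAWScalingLimit.Theorems.StripMass.criticalFugacity_pos.le

/-- Budget-swap bookkeeping in `ℝ≥0∞`: if `b ≤ 1` and `c ≤ n` then `b·n + c ≤ b·c + n`. -/
theorem budget_swap {b c n : ℝ≥0∞} (hb : b ≤ 1) (hcn : c ≤ n) : b * n + c ≤ b * c + n := by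
  obtain ⟨d, rfl⟩ := exists_add_of_le hcn
  calc b * (c + d) + c = b * c + (b * d + c) := by ring
    _ ≤ b * c + (1 * d + c) := by gcongr
    _ = b * c + (c + d) := by ring

/-- A sector kernel is finite on a graph with finitely many non-isolated vertices. -/
theorem sectorKernel_ne_top {H : SimpleGraph V} (hfin : H.support.Finite) (x : ℝ) (A : Set V)
    (a b : V) : sectorKernel H x A a b ≠ ∞ :=
  ne_top_of_le_ne_top (pathKernel_ne_top hfin x a b) (pathKernelOn_le x a b _)

/-- THE INDUCTIVE STEP ON TWO-EDGE QUADRUPLES: budget (`stub_entangledBudget`) + Cauchy–Binet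
(`stub_singleCrossingCauchyBinet` fed by `stub_cutPairSign`) + `spanOneBudget ≤ 1` give the two-edge
TP₂ inequality for `H` from interlacing-only TP₂ below `H`. -/
theorem twoEdgeTP2On_of_ihBelow (H : SimpleGraph (Site 2)) (hH : H ≤ zdGraph 2)
    (hfin : H.support.Finite) (ih : IHBelow SAW.criticalFugacity H) :
    TwoEdgeTP2On SAW.criticalFugacity H := by
  intro p₁ p₂ p₃ p₄ h12 h13 h14 h23 h24 h34 he hf hI
  obtain ⟨A, hA₁, hA₄, hA₂, hA₃, hbud⟩ :=
    stub_entangledBudget H hH hfin ih p₁ p₂ p₃ p₄ h12 h13 h14 h23 h24 h34 he hf hI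
  have hx := criticalFugacity_nonneg
  have hCB : sectorKernel H SAW.criticalFugacity A p₁ p₃ * sectorKernel H SAW.criticalFugacity A p₄ p₂ ≤
      sectorKernel H SAW.criticalFugacity A p₁ p₂ * sectorKernel H SAW.criticalFugacity A p₄ p₃ :=
    stub_singleCrossingCauchyBinet H SAW.criticalFugacity hx hfin A p₁ p₂ p₃ p₄ hA₁ hA₄ hA₂ hA₃
      fun u v u' v' huv hu hv hu'v' hu' hv' hne =>
        stub_cutPairSign SAW.criticalFugacity hx H hH hfin ih A p₁ p₂ p₃ p₄ hA₁ hA₄ hA₂ hA₃ he hf hI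
          u v u' v' huv hu hv hu'v' hu' hv' hne
  have hB : ENNReal.ofReal spanOneBudget ≤ 1 := ENNReal.ofReal_le_one.2 spanOneBudget_le_one
  -- abbreviations
  set C := pathKernel H SAW.criticalFugacity p₁ p₃ * pathKernel H SAW.criticalFugacity p₄ p₂ with hC
  set N := pathKernel H SAW.criticalFugacity p₁ p₂ * pathKernel H SAW.criticalFugacity p₄ p₃ with hN
  set C₁ := sectorKernel H SAW.criticalFugacity A p₁ p₃ * sectorKernel H SAW.criticalFugacity A p₄ p₂
    with hC₁
  set N₁ := sectorKernel H SAW.criticalFugacity A p₁ p₂ * sectorKernel H SAW.criticalFugacity A p₄ p₃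
    with hN₁
  set B := ENNReal.ofReal spanOneBudget with hBdef
  have hfinite : B * C₁ + N₁ ≠ ∞ := by
    refine ENNReal.add_ne_top.2 ⟨ENNReal.mul_ne_top ENNReal.ofReal_ne_top ?_, ?_⟩
    · exact ENNReal.mul_ne_top (sectorKernel_ne_top hfin _ A _ _) (sectorKernel_ne_top hfin _ A _ _)
    · exact ENNReal.mul_ne_top (sectorKernel_ne_top hfin _ A _ _) (sectorKernel_ne_top hfin _ A _ _)
  have key : C + (B * C₁ + N₁) ≤ N + (B * C₁ + N₁) :=
    calc C + (B * C₁ + N₁) = C + B * C₁ + N₁ := (add_assoc _ _ _).symm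
      _ ≤ N + B * N₁ + C₁ := hbud
      _ = N + (B * N₁ + C₁) := add_assoc _ _ _
      _ ≤ N + (B * C₁ + N₁) := add_le_add le_rfl (budget_swap hB hCB)
  have hCN : C ≤ N := (ENNReal.add_le_add_iff_right hfinite).1 key
  -- reorient `Z(p₄,p₂) = Z(p₂,p₄)`, `Z(p₄,p₃) = Z(p₃,p₄)`
  rw [hC, hN, pathKernel_comm H _ p₄ p₂, pathKernel_comm H _ p₄ p₃] at hCN
  exact hCN

/-- Interlacing-only TP₂ at `x_c` for every finite subgraph of `ℤ²`, by strong induction on the number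
of edges: the inductive step is `stub_twoEdgeReduction` applied to `twoEdgeTP2On_of_ihBelow` and the base
family `stub_boundaryThreePoint`. -/
theorem interlacedTP2On_criticalFugacity :
    ∀ (n : ℕ) (H : SimpleGraph (Site 2)), H ≤ zdGraph 2 → H.support.Finite →
      H.edgeSet.ncard = n → InterlacedTP2On SAW.criticalFugacity H := by
  intro n
  induction n using Nat.strong_induction_on with
  | _ n ihn =>
    intro H hH hfin hn
    have ih : IHBelow SAW.criticalFugacity H := fun H' hH' hfin' hlt =>
      ihn (H'.edgeSet.ncard) (hn ▸ hlt) H' hH' hfin' rfl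
    exact stub_twoEdgeReduction SAW.criticalFugacity criticalFugacity_nonneg H hH hfin ih
      (twoEdgeTP2On_of_ihBelow H hH hfin ih) stub_boundaryThreePoint

/-- The interlacing-only strengthening `InterlacedTP2At x_c` (lead's carrier) from the stubs. -/
theorem interlacedTP2At_criticalFugacity : InterlacedTP2At SAW.criticalFugacity :=
  fun H hH hfin => interlacedTP2On_criticalFugacity _ H hH hfin rfl

/-- **Composition of the line**: the crux `BoundaryTP2`, BY NAME, from the five registered stubs —
`InterlacedTP2At x_c` (above) ⇒ `GraphTP2At x_c` (`graphTP2At_of_interlacedTP2At`, landed) ⇒ the crux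
(`boundaryTP2_of_graphTP2At`, landed transfer). -/
theorem BoundaryTP2_of :
    Summit.CriticalPhenomena.SAWScalingLimit.Theses.SAWTotalPositivity.BoundaryTP2 :=
  boundaryTP2_of_graphTP2At (graphTP2At_of_interlacedTP2At interlacedTP2At_criticalFugacity)

end Summit.CriticalPhenomena.SAWScalingLimit.Cruxes.BoundaryTP2.RenewalCauchyBinetKestenBudget

end
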